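import Summits.HodgeConjecture.HodgeConjecture.Theorems.GenericDivisibilityHodgeClassesGenericallyDivisible
import Literature.AlgebraicGeometry.HodgeTheory.SurjectivePullbackAlgebraicClasses
import Literature.AlgebraicGeometry.HodgeTheory.GysinFormalismCorrespondences
import HarnessLib

/-!
# The crux `GenericDivisibilityBounded` (C2, stmt-HodgeConjecture-18467) descends along surjective
# morphisms of smooth projective varieties of the same dimension

Line `finite-level-bootstrap`, registered sub-goal `stub_cruxAtOfSurjective` (lead c4). Sorry-free,
definition-free. `X`, `X'` are smooth projective over `ℂ` of the same dimension, `f : X' ⟶ X` is a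
`ℂ`-morphism whose underlying map of points is onto, `z| = z|_{(X∖Z)(ℂ)}` is the restriction of an
integral class to the complex points of a Zariski open, and "C2 at `X` in degree `k`" is, spelled
inline: every `z ∈ H^k(X(ℂ);ℤ)` which for every `m ≥ 1` is an `m`-multiple on the complex points of
some non-empty Zariski open has complexification in `N¹ = supportedClasses X k 1`.

## Main results

* `genericDivisibilityBounded_preimage_ne_univ` — `f⁻¹Z ≠ X'` for `Z ≠ X` and `f` onto;
* `genericDivisibilityBounded_restrict_map` — restriction to `(X' ∖ f⁻¹Z)(ℂ)` commutes with
  pull-back, integral coefficients (the `ℤ`-twin of `complexBetti.restrictCompl_map`);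
* `genericDivisibilityBounded_divisible_map` — the crux HYPOTHESIS pulls back: the witnesses
  `(Z, y)` of `z` give the witnesses `(f⁻¹Z, (f|)^* y)` of `f^* z`;
* `genericDivisibilityBounded_at_of_surjective` — **C2 at `X'` in degree `k` implies C2 at `X` in
  degree `k`**: `f^*(z ⊗ ℂ) = (f^* z) ⊗ ℂ ∈ N¹H^k(X'(ℂ);ℂ)` by C2 at `X'`, and coniveau descends along
  surjective equidimensional morphisms (`mem_supportedClasses_of_map_mem_of_surjective`:
  `x = c⁻¹ • f_* f^* x`, Voisin I Remark 7.29, and Gysin images keep their coniveau);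
* `genericDivisibilityBounded_at_of_isBirational` — in particular C2 descends from any smooth
  projective birational model (a proper birational morphism is onto);
* `stub_cruxAtOfSurjective` — the registered signature, verbatim (`k = 2p`).

References: [VoisinHodgeI2002] §7.3.2 Lemma 7.28, Remark 7.29; [FultonYoungTableaux1997] App. B
§B.1 (5)–(7); [HatcherAT2002] §3.1; [ColliotTheleneVoisin2012] §3.
-/

set_option linter.dupNamespace false

noncomputable section

namespace Summit.HodgeConjecture.HodgeConjecture.Theorems

open CategoryTheory AlgebraicGeometry
open Literature.AlgebraicGeometry.Motives Literature.AlgebraicGeometry.HodgeTheory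
  Literature.AlgebraicTopology.SingularHomology

/-- Restriction `H^k(X(ℂ);ℤ) → H^k((X∖Z)(ℂ);ℤ)`, the very term of the route decls (notation only). -/
local notation3 (prettyPrint := false) "Res[" X ", " Z ", " k "]" =>
  singularCohomology.map ℤ ℤ
    (⟨Subtype.val, continuous_subtype_val⟩ : C(complexPointsCompl X Z, ComplexPoints X)) k

/-! ### Pulling the witnesses back along `f` -/

/-- The preimage of a proper subset under a map which is onto is a proper subset. [folklore] -/
theorem genericDivisibilityBounded_preimage_ne_univ {X' X : SchemeOver ℂ} (f : X' ⟶ X)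
    (hf : Function.Surjective f.left.base) {Z : Set X.left} (hZ : Z ≠ Set.univ) :
    f.left.base ⁻¹' Z ≠ Set.univ := fun h ↦
  hZ (Set.eq_univ_of_univ_subset (hf.range_eq ▸ Set.preimage_eq_univ_iff.1 h))

/-- **Restriction commutes with pull-back, integral coefficients**:
`(f^* z)|_{(X' ∖ f⁻¹Z)(ℂ)} = (f|)^* (z|_{(X ∖ Z)(ℂ)})`, where `f| : (X' ∖ f⁻¹Z)(ℂ) → (X ∖ Z)(ℂ)` is
`complexPointsComplMap f Z` (contravariant functoriality of `Hⁿ` on the commuting square of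
inclusions, Hatcher §3.1; the tree's `complexBetti.restrictCompl_map` is the case of
`ℂ`-coefficients). [cite: HatcherAT2002, §3.1] -/
theorem genericDivisibilityBounded_restrict_map {X' X : SchemeOver ℂ} (f : X' ⟶ X)
    (Z : Set X.left) (k : ℕ) (z : singularCohomology ℤ ℤ (ComplexPoints X) k) :
    Res[X', f.left.base ⁻¹' Z, k]
        (singularCohomology.map ℤ ℤ (AlgPoints.mapContinuous (L := ℂ) f) k z) =
      singularCohomology.map ℤ ℤ (complexPointsComplMap f Z) k (Res[X, Z, k] z) := by
  rw [← ModuleCat.comp_apply, ← singularCohomology.map_comp, ← ModuleCat.comp_apply,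
    ← singularCohomology.map_comp]
  rfl

/-- **The crux hypothesis pulls back.** If `z ∈ H^k(X(ℂ);ℤ)` is, for every `m ≥ 1`, an
`m`-multiple on the complex points of some non-empty Zariski open `X ∖ Z_m`, then so is `f^* z` on
`X'`, for any `f : X' ⟶ X` which is onto: `f⁻¹Z_m` is closed and `≠ X'`, and
`(f^* z)| = (f|)^*(z|) = (f|)^*(m • y_m) = m • (f|)^* y_m`. [cite: HatcherAT2002, §3.1] -/
theorem genericDivisibilityBounded_divisible_map {X' X : SchemeOver ℂ} (f : X' ⟶ X)
    (hf : Function.Surjective f.left.base) {k : ℕ} {z : singularCohomology ℤ ℤ (ComplexPoints X) k}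
    (hz : ∀ m : ℕ, 1 ≤ m → ∃ Z : Set X.left, IsClosed Z ∧ Z ≠ Set.univ ∧
      ∃ y : singularCohomology ℤ ℤ (complexPointsCompl X Z) k, m • y = Res[X, Z, k] z)
    (m : ℕ) (hm : 1 ≤ m) :
    ∃ Z' : Set X'.left, IsClosed Z' ∧ Z' ≠ Set.univ ∧
      ∃ y' : singularCohomology ℤ ℤ (complexPointsCompl X' Z') k,
        m • y' = Res[X', Z', k] (singularCohomology.map ℤ ℤ (AlgPoints.mapContinuous (L := ℂ) f) k z) := by
  obtain ⟨Z, hZ, hZne, y, hy⟩ := hz m hm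
  refine ⟨f.left.base ⁻¹' Z, hZ.preimage f.left.continuous,
    genericDivisibilityBounded_preimage_ne_univ f hf hZne,
    singularCohomology.map ℤ ℤ (complexPointsComplMap f Z) k y, ?_⟩
  rw [← map_nsmul, hy, genericDivisibilityBounded_restrict_map]

/-! ### C2 descends along surjective equidimensional morphisms -/

/-- **C2 descends along surjective morphisms of smooth projective varieties of the same dimension.**
Let `f : X' ⟶ X` be onto, `X'`, `X` smooth projective of dimension `n`, and suppose C2 holds at `X'`
in degree `k`: every integral class on `X'(ℂ)` divisible by every `m ≥ 1` on the complex points of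
some non-empty Zariski open has complexification in `N¹H^k(X'(ℂ);ℂ)`. Then C2 holds at `X` in degree
`k`: for such a `z` on `X`, `f^* z` is such a class on `X'`
(`genericDivisibilityBounded_divisible_map`), so `(f^* z) ⊗ ℂ = f^*(z ⊗ ℂ) ∈ N¹` (change of
coefficients commutes with pull-back), and coniveau descends along `f`: `z ⊗ ℂ = c⁻¹ • f_* f^*(z ⊗ ℂ)`
with `c = deg f ≠ 0` (Voisin I, Remark 7.29), Gysin images keeping their coniveau
(`mem_supportedClasses_of_map_mem_of_surjective`). [cite: VoisinHodgeI2002, §7.3.2 Remark 7.29] -/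
theorem genericDivisibilityBounded_at_of_surjective {n : ℕ} {X' X : SchemeOver ℂ} (f : X' ⟶ X)
    (hX' : IsSmoothProjective n X') (hX : IsSmoothProjective n X)
    (hf : Function.Surjective f.left.base) (k : ℕ)
    (hC : ∀ z' : singularCohomology ℤ ℤ (ComplexPoints X') k,
      (∀ m : ℕ, 1 ≤ m → ∃ Z : Set X'.left, IsClosed Z ∧ Z ≠ Set.univ ∧
        ∃ y : singularCohomology ℤ ℤ (complexPointsCompl X' Z) k, m • y = Res[X', Z, k] z') →
      singularCohomology.ringChange (Int.castRingHom ℂ) (ComplexPoints X') k z' ∈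
        supportedClasses X' k 1)
    (z : singularCohomology ℤ ℤ (ComplexPoints X) k)
    (hz : ∀ m : ℕ, 1 ≤ m → ∃ Z : Set X.left, IsClosed Z ∧ Z ≠ Set.univ ∧
      ∃ y : singularCohomology ℤ ℤ (complexPointsCompl X Z) k, m • y = Res[X, Z, k] z) :
    singularCohomology.ringChange (Int.castRingHom ℂ) (ComplexPoints X) k z ∈
      supportedClasses X k 1 := by
  haveI : AlgebraicGeometry.Surjective f.left := ⟨hf⟩
  refine mem_supportedClasses_of_map_mem_of_surjective hX' hX f ?_
  change singularCohomology.map ℂ ℂ (AlgPoints.mapContinuous (L := ℂ) f) k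
      (singularCohomology.ringChange (Int.castRingHom ℂ) (ComplexPoints X) k z) ∈ _
  rw [← genericDivisibility_ringChange_map]
  exact hC _ (genericDivisibilityBounded_divisible_map f hf hz)

/-- **C2 descends from a smooth projective birational model**: for `σ : X' ⟶ X` between smooth
projective varieties of the same dimension with `σ.left` birational, C2 at `X'` in degree `k` implies
C2 at `X` in degree `k` (`σ.left` is proper, being a morphism of projective varieties, and a proper
birational morphism is onto: `surjective_base_of_isBirational`).
[cite: VoisinHodgeI2002, §7.3.2 Remark 7.29] -/
theorem genericDivisibilityBounded_at_of_isBirational {n : ℕ} {X' X : SchemeOver ℂ} (σ : X' ⟶ X)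
    (hX' : IsSmoothProjective n X') (hX : IsSmoothProjective n X)
    (hσ : Literature.AlgebraicGeometry.Resolution.IsBirational σ.left) (k : ℕ)
    (hC : ∀ z' : singularCohomology ℤ ℤ (ComplexPoints X') k,
      (∀ m : ℕ, 1 ≤ m → ∃ Z : Set X'.left, IsClosed Z ∧ Z ≠ Set.univ ∧
        ∃ y : singularCohomology ℤ ℤ (complexPointsCompl X' Z) k, m • y = Res[X', Z, k] z') →
      singularCohomology.ringChange (Int.castRingHom ℂ) (ComplexPoints X') k z' ∈
        supportedClasses X' k 1)
    (z : singularCohomology ℤ ℤ (ComplexPoints X) k)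
    (hz : ∀ m : ℕ, 1 ≤ m → ∃ Z : Set X.left, IsClosed Z ∧ Z ≠ Set.univ ∧
      ∃ y : singularCohomology ℤ ℤ (complexPointsCompl X Z) k, m • y = Res[X, Z, k] z) :
    singularCohomology.ringChange (Int.castRingHom ℂ) (ComplexPoints X) k z ∈
      supportedClasses X k 1 :=
  haveI : IsProper σ.left := isProper_left_of_isSmoothProjective hX' hX σ
  genericDivisibilityBounded_at_of_surjective σ hX' hX (surjective_base_of_isBirational σ.left hσ)
    k hC z hz

/-! ### The registered sub-goal -/

/-- **Registered sub-goal `stub_cruxAtOfSurjective` of stmt-HodgeConjecture-18467 (line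
`finite-level-bootstrap`): C2 descends along surjective morphisms of smooth projective `2p`-folds** —
for `f : X' ⟶ X` onto on points, C2 at `X'` implies C2 at `X`: the divisibility witnesses of `z` pull
back to witnesses of `f^* z` (`f⁻¹Z ≠ X'` by surjectivity), C2 at `X'` puts `f^*(z ⊗ ℂ)` in
`N¹H^{2p}(X'(ℂ);ℂ)`, and coniveau descends along surjective equidimensional morphisms
(`x = c⁻¹ • f_* f^* x`, Voisin I Remark 7.29). Proof: `genericDivisibilityBounded_at_of_surjective`
at `k = 2p` (the hypothesis `1 ≤ p` is not needed). [cite: VoisinHodgeI2002, §7.3.2 Remark 7.29] -/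
theorem stub_cruxAtOfSurjective :
    ∀ ⦃p : ℕ⦄ ⦃X' X : SchemeOver ℂ⦄ (f : X' ⟶ X), 1 ≤ p → IsSmoothProjective (2 * p) X' →
      IsSmoothProjective (2 * p) X → Function.Surjective f.left.base →
      (∀ z' : singularCohomology ℤ ℤ (ComplexPoints X') (2 * p),
        (∀ m : ℕ, 1 ≤ m → ∃ Z : Set X'.left, IsClosed Z ∧ Z ≠ Set.univ ∧
          ∃ y : singularCohomology ℤ ℤ (complexPointsCompl X' Z) (2 * p),
            m • y = singularCohomology.map ℤ ℤ
              (⟨Subtype.val, continuous_subtype_val⟩ : C(complexPointsCompl X' Z, ComplexPoints X'))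
              (2 * p) z') →
        singularCohomology.ringChange (Int.castRingHom ℂ) (ComplexPoints X') (2 * p) z' ∈
          supportedClasses X' (2 * p) 1) →
      ∀ z : singularCohomology ℤ ℤ (ComplexPoints X) (2 * p),
        (∀ m : ℕ, 1 ≤ m → ∃ Z : Set X.left, IsClosed Z ∧ Z ≠ Set.univ ∧
          ∃ y : singularCohomology ℤ ℤ (complexPointsCompl X Z) (2 * p),
            m • y = singularCohomology.map ℤ ℤ
              (⟨Subtype.val, continuous_subtype_val⟩ : C(complexPointsCompl X Z, ComplexPoints X))
              (2 * p) z) →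
        singularCohomology.ringChange (Int.castRingHom ℂ) (ComplexPoints X) (2 * p) z ∈
          supportedClasses X (2 * p) 1 :=
  fun p _ _ f _ hX' hX hf hC z hz ↦
    genericDivisibilityBounded_at_of_surjective f hX' hX hf (2 * p) hC z hz

end Summit.HodgeConjecture.HodgeConjecture.Theorems

end
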